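import Literature.MathematicalPhysics.QuantumFieldTheory.QCDOS
import Literature.MathematicalPhysics.QuantumLattice.GrassmannIntegralProofs
import Literature.MathematicalPhysics.QuantumLattice.HubbardWave0
import HarnessLib

/-!
# The positive transfer matrix of lattice QCD with `r = 1` Wilson quarks and its spectral gap

Definition request `defn-qcdTransferGap` (route `QuarkMassMonotone` of `QuantumFields/QCD`, card
heavier-quarks-never-refine, D1): the spectral gap `qcdTransferGap N_f β S m` of the self-adjoint,
positive one-step transfer operator of lattice QCD (`SU(3)`, `N_f` flavours of `r = 1` Wilson quarks
with bare masses `m_f`, i.e. hopping parameters `κ_f = 1/(2m_f + 8)`, inverse bare coupling `β` in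
the TREE's normalisation `β = 2/g₀²` of `wilsonMeasure`) on the spatial three-torus of side `S`,
acting on the gauge-invariant subspace of `L²(SU(3)^{spatial links}, Haar) ⊗ (fermionic Fock space
of the quark modes of ONE time slice)`.

## Sources and what is formalised

* Lüscher, CMP 54 (1977) 283 [Luscher1977]: for `r = 1` Wilson fermions coupled to Wilson's gauge
  action the Euclidean functional integral is `Tr 𝕋^N` for a bounded, self-adjoint, strictly
  positive transfer operator `𝕋` on the gauge-invariant subspace of `L²(gauge fields) ⊗ Fock`;
  positivity holds for `|κ| < 1/6` (Montvay–Münster (4.111) [MontvayMunster1994]: the matrix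
  `B = 1 − κ·(spatial hopping)` is positive definite), i.e. `m_f > −1` in the tree's normalisation.
* Smit, *Introduction to Quantum Fields on a Lattice* (2023) [Smit2023], §6.5 (6.73)–(6.95) and
  §4.6 (4.121)–(4.137), App. C (C.61)–(C.70): the explicit operator we transcribe. In temporal gauge,
  with `P^± = (1 ± γ₄)/2`, `A(U) = M − ½∑ⱼ(U_{x,x+ĵ} δ + h.c.)` (6.74) (`M_f = m_f + 4`, `ε = a₄/a = 1`),
  `D(U) = ∑ⱼ αⱼ (1/2i)(U_{x,x+ĵ}δ − h.c.)`, `αⱼ = iγ₄γⱼ` (6.75), the fermionic transfer operator in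
  the charge-conserving form (6.91) is
  `T̂_F(U) = e^{−ψ̂† P⁻DP⁺ ψ̂} e^{−ψ̂† γ₄ ln A ψ̂} e^{Tr P⁺ ln A} e^{−ψ̂† P⁺DP⁻ ψ̂}`,
  and the full operator is `T̂ = T̂_F^{1/2} T̂_U T̂_F^{1/2} P̂₀` (6.87), `T̂_U = e^{−½Ŵ} T̂_K e^{−½Ŵ}`
  (4.121), `⟨U'|T̂_K|U⟩ = ∏_links exp[(2/g₀²) Re tr(U_l U'_l†)]` (4.129), `Ŵ` = spatial plaquette
  term (4.122), `P̂₀` = projector on gauge-invariant wave functions (4.127)–(4.137).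
* The tree's `wilsonDirac ρ U m 1` (GrassmannIntegral.lean) IS Smit's action at `r = 1`:
  diagonal `m + 4`, forward hop `−½(1 − γ_μ)ρ(U(x,μ))`, backward hop `−½(1 + γ_μ)ρ(U(y,μ))⁻¹`,
  time hops `+ψ̄ₜP⁻ψₜ₊₁ + ψ̄ₜ₊₁P⁺ψₜ` in the weight; Euclidean time is coordinate `0`
  (as in `qcdLatticeConnectedCorr`), so `γ₄ := euclideanGamma 0` and the spatial directions
  `j : Fin 3` of the three-torus are the four-torus directions `j.succ`.

## How it is rendered (no operator theory needed: min–max on a form core)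

* `fockLift X = Γ(X)`, the Fock-space (exterior power) functor in the occupation basis
  `Fock ι = Finset ι → ℂ` of `HubbardWave0` (`Γ(X)_{s,t} = det X[s;t]`, increasing enumerations);
  `e^{ψ̂†Xψ̂} = Γ(e^X)` (Smit (C.62)) and `Γ(X)Γ(Y) = Γ(XY)` turn (6.91) into the closed form
  `T̂_F(U) = (det A_red)² · Γ((1 − N)(P⁺A⁻¹ + P⁻A)(1 − N†))`, `N = P⁻DP⁺` (`N² = 0`, so
  `e^{−N} = 1 − N`; `e^{−γ₄ ln A} = P⁺A⁻¹ + P⁻A`; `e^{Tr P⁺ ln A} = (det A_red)²`, `A = A_red ⊗ 1₄`):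
  `fermionSliceOp`. No matrix logarithm or square root is needed.
* The gauge kernel `gaugeSliceKernel β U U' = e^{−(β/2)S₃(U)} e^{−β∑ₗ(3 − Re tr U_l U'_l†)} e^{−(β/2)S₃(U')}`
  (`S₃ = wilsonAction` of the three-torus; tree weight `e^{−β∑ₚ(3 − Re tr Uₚ)}`, temporal
  plaquettes in temporal gauge; constants kept, they cancel in the gap).
* The Rayleigh quotient of `T̂` at the vector `T̂_F^{1/2}Ψ` is, WITHOUT square roots,
  `R(Ψ) = ⟨T̂_FΨ, T̂_U T̂_FΨ⟩ / ⟨Ψ, T̂_FΨ⟩` (`transferForm` / `fermionWeightForm`), and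
  `Ψ ↦ T̂_F^{1/2}Ψ` preserves the core of continuous gauge-invariant wave functions (dense in the
  gauge-invariant subspace: `P̂₀` maps `C(SU(3)^E; Fock)` onto it). By the min–max principle
  (Reed–Simon IV, Thm XIII.1 [ReedSimonIV1978]) the numbers `qcdTransferLevel … n =
  inf_{Φ₁…Φₙ} sup {R(Ψ) : ⟨Φᵢ, T̂_FΨ⟩ = 0}` are the eigenvalues `λ₀ ≥ λ₁ ≥ ⋯` of `T̂` on the
  gauge-invariant subspace counted with multiplicity (down to the top of the essential spectrum),
  and `qcdTransferGap = log λ₀ − log λ₁ = −log(λ₁/λ₀)` is the gap relative to the vacuum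
  eigenvalue (`0` if the top eigenvalue is degenerate). Other groupings of the same cyclic slice
  product (Lüscher's, or `T̂_U T̂_F`) give operators with the same non-zero spectrum and
  multiplicities (`σ(XY) ∖ {0} = σ(YX) ∖ {0}`), so the levels do not depend on that choice.

## Junk values / scope

Meaningful for `β ≥ 0` and all `m_f > −1` (`κ_f < 1/6`), where `A > 0`, `T̂_F(U) > 0`, `T̂_U ≥ 0`.
Outside: `A⁻¹` is Mathlib's junk inverse, the forms are indefinite and `sSup`/`sInf`/`Real.log`
return junk (`sSup` of an unbounded set and `log 0` are `0`). `qcdTransferGap` is `0` also when the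
top eigenvalue is degenerate (intended). The companion statement "volume-uniform clustering of
`qcdLatticeConnectedCorr` at rate `δ` ⇔ `qcdTransferGap ≥ δ` as `S → ∞`" is NOT vendored: it is
not printed in this finite-torus, `(−1)^F`-twisted form (periodic `wilsonDirac` gives
`Tr[(−1)^N̂ ⋯]`, Smit (C.70)); its abstract form is `TransferData.HasMassGap` /
`timeClustering_iff_massGap` (LatticeMassGap.lean) and it should be filed as a route item.
-/

open _root_.MeasureTheory Matrix
open Literature.MathematicalPhysics.QuantumLattice Literature.Probability.LatticeModels

noncomputable section

namespace Literature.MathematicalPhysics.QuantumFieldTheory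

local notation "𝔾" => Matrix.specialUnitaryGroup (Fin 3) ℂ

/-! ### The Fock-space functor `Γ` on `Fock ι = Finset ι → ℂ` -/

section FockLift

variable {ι : Type*} [LinearOrder ι]

/-- **Second quantisation `Γ(X)` of a one-particle matrix** on the fermionic Fock space
`Fock ι = Finset ι → ℂ` (occupation basis `|s⟩ = c†_{i₁}⋯c†_{iₖ}|0⟩`, `i₁ < ⋯ < iₖ`, of
`HubbardWave0`, where `c†ᵢ` is left exterior multiplication by `eᵢ`): `Γ(X)|t⟩ = Xe_{j₁} ∧ ⋯ ∧ Xe_{jₖ}`,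
i.e. the matrix of `k × k` minors `Γ(X)_{s,t} = det (X_{sₐ,t_b})_{a,b}` (increasing enumerations),
`0` if `#s ≠ #t`. Second-quantised exponentials are `exp(∑ᵢⱼ Xᵢⱼ c†ᵢcⱼ) = Γ(e^X)` (Smit (C.62):
the normal symbol of `e^{â†Mâ}` is `exp(a⁺e^Ma)`), and `Γ(XY) = Γ(X)Γ(Y)` (Cauchy–Binet).
[cite: Smit2023, App. C (C.62)] -/
def fockLift (X : Matrix ι ι ℂ) : Matrix (Finset ι) (Finset ι) ℂ :=
  Matrix.of fun s t =>
    if h : t.card = s.card then (X.submatrix ⇑(s.orderEmbOfFin rfl) ⇑(t.orderEmbOfFin h)).det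
    else 0

/-- The column of `Γ(X)` at the Fock vacuum `|∅⟩`: `Γ(X)_{s,∅} = [s = ∅]` (the empty minor is `1`). [folklore] -/
theorem fockLift_apply_empty (X : Matrix ι ι ℂ) (s : Finset ι) :
    fockLift X s ∅ = if s = ∅ then 1 else 0 := by
  by_cases hs : s = ∅
  · subst hs
    rw [fockLift, Matrix.of_apply, dif_pos rfl, if_pos rfl]
    exact Matrix.det_eq_one_of_card_eq_zero (by simp)
  · have h : ¬ ((∅ : Finset ι).card = s.card) := by
      rw [Finset.card_empty]
      exact fun h => hs (Finset.card_eq_zero.mp h.symm)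
    rw [fockLift, Matrix.of_apply, dif_neg h, if_neg hs]

/-- On the one-particle sector `Γ(X)` is `X` itself: `⟨{i}|Γ(X)|{j}⟩ = Xᵢⱼ`. [folklore] -/
theorem fockLift_singleton (X : Matrix ι ι ℂ) (i j : ι) : fockLift X {i} {j} = X i j := by
  have hc : ({j} : Finset ι).card = ({i} : Finset ι).card := by simp
  have h0 : 0 < ({i} : Finset ι).card := by simp
  rw [fockLift, Matrix.of_apply, dif_pos hc, Matrix.det_eq_elem_of_card_eq_one (by simp) ⟨0, h0⟩,
    Matrix.submatrix_apply]
  have hi : ({i} : Finset ι).orderEmbOfFin rfl ⟨0, h0⟩ = i :=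
    Finset.mem_singleton.mp (Finset.orderEmbOfFin_mem _ _ _)
  have hj : ({j} : Finset ι).orderEmbOfFin hc ⟨0, h0⟩ = j :=
    Finset.mem_singleton.mp (Finset.orderEmbOfFin_mem _ _ _)
  rw [hi, hj]

variable [Fintype ι]

/-- `Γ(X)` fixes the Fock vacuum: `Γ(X)|0⟩ = |0⟩` for every one-particle matrix `X`. [folklore] -/
theorem fockLift_mulVec_vacuum (X : Matrix ι ι ℂ) :
    fockLift X *ᵥ (vacuum : Fock ι) = vacuum := by
  funext s
  simp only [vacuum, Matrix.mulVec, dotProduct, Pi.single_apply, mul_ite, mul_one, mul_zero,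
    Finset.sum_ite_eq', Finset.mem_univ, if_true, fockLift_apply_empty]

end FockLift

/-! ### One time slice of lattice QCD on the spatial three-torus of side `S` -/

section Slice

variable (Nf S : ℕ) [NeZero S]

/-- Quark modes of one time slice: flavour × (spatial site × colour × Dirac index) — the index of
the operators `ψ̂` of Smit (6.89)–(6.90) (four modes per site, colour and flavour). [cite: Smit2023, §6.5 (6.89)–(6.90)] -/
abbrev SliceQuarkVar : Type := Fin Nf × (TorusSite 3 S × Fin 3 × Fin 4)

/-- The spin-blind part of the index: flavour × (spatial site × colour). [folklore] -/
abbrev SliceColourVar : Type := Fin Nf × (TorusSite 3 S × Fin 3)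

/-- A linear enumeration of the slice quark modes (the Jordan–Wigner model `Fock` needs a linear
order). [folklore] -/
abbrev SliceFermiIdx : Type := Fin (Fintype.card (SliceQuarkVar Nf S))

variable {Nf S}

/-- The fixed enumeration of the slice quark modes. [folklore] -/
def sliceQuarkEquiv : SliceQuarkVar Nf S ≃ SliceFermiIdx Nf S := Fintype.equivFin _

/-- `B ⊗ Γ`: a spin-blind matrix `B` times a `4 × 4` spin matrix `Γ`, on the slice quark modes. [folklore] -/
def sliceKron (B : Matrix (SliceColourVar Nf S) (SliceColourVar Nf S) ℂ) (Γ : Matrix (Fin 4) (Fin 4) ℂ) :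
    Matrix (SliceQuarkVar Nf S) (SliceQuarkVar Nf S) ℂ :=
  Matrix.of fun p q => B (p.1, p.2.1, p.2.2.1) (q.1, q.2.1, q.2.2.1) * Γ p.2.2.2 q.2.2.2

/-- `P⁺ = (1 + γ₄)/2` with `γ₄ := euclideanGamma 0` (Euclidean time = coordinate `0` of the
four-torus, chiral basis; `P^±` are the rank-two spectral projections of `γ₄` in any basis).
[cite: Smit2023, §6.5 (6.77)] -/
def timeProjPlus : Matrix (Fin 4) (Fin 4) ℂ := (1 / 2 : ℂ) • (1 + euclideanGamma 0)

/-- `P⁻ = (1 − γ₄)/2`, `γ₄ := euclideanGamma 0`. [cite: Smit2023, §6.5 (6.77)] -/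
def timeProjMinus : Matrix (Fin 4) (Fin 4) ℂ := (1 / 2 : ℂ) • (1 - euclideanGamma 0)

/-- `P⁺ + P⁻ = 1`. [folklore] -/
theorem timeProjPlus_add_timeProjMinus : timeProjPlus + timeProjMinus = 1 := by
  rw [timeProjPlus, timeProjMinus, ← smul_add, add_add_sub_cancel, ← two_smul ℂ, smul_smul]
  norm_num

/-- `P⁺P⁻ = 0` (from `γ₄² = 1`, `euclideanGamma_mul_self`): with `P⁺ + P⁻ = 1`, `P^±` are the
complementary spectral projections of `γ₄` (rank two each), in any basis. [folklore] -/
theorem timeProjPlus_mul_timeProjMinus : timeProjPlus * timeProjMinus = 0 := by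
  have h : ((1 : Matrix (Fin 4) (Fin 4) ℂ) + euclideanGamma 0) * (1 - euclideanGamma 0) = 0 := by
    rw [add_mul, mul_sub, mul_sub, one_mul, one_mul, mul_one, euclideanGamma_mul_self]
    abel
  rw [timeProjPlus, timeProjMinus, smul_mul_assoc, mul_smul_comm, h, smul_zero, smul_zero]

/-- The forward colour hop in the spatial direction `j` of the background `U`:
`(W_j)_{(f,x,a),(f',y,b)} = δ_{ff'} δ_{y,x+ĵ} U(x,j)_{ab}` (fundamental representation on the
forward hop, the tree's link orientation of `wilsonDirac`; `W_jᴴ` is the backward hop with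
`U(x,j)⁻¹ = U(x,j)ᴴ`). [cite: Smit2023, §6.5 (6.74)] -/
def colourHop (U : GaugeConfig 3 S 𝔾) (j : Fin 3) :
    Matrix (SliceColourVar Nf S) (SliceColourVar Nf S) ℂ :=
  Matrix.of fun p q =>
    if p.1 = q.1 ∧ q.2.1 = QuantumFieldTheory.Site.shift p.2.1 j then
      (U (p.2.1, j) : Matrix (Fin 3) (Fin 3) ℂ) p.2.2 q.2.2 else 0

/-- **Smit's `A(U)` = Lüscher's `B`** (spin-blind): `A = diag(m_f + 4) − ½∑ⱼ(W_j + W_jᴴ)`, the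
`r = 1` Wilson mass-plus-spatial-Wilson term of one time slice (`M_f = m_f + 4r`, `ε = a₄/a = 1`;
in hopping form `A ∝ 1 − κ·hop`, positive definite iff all `κ_f = 1/(2m_f + 8) < 1/6`, i.e.
`m_f > −1`, Montvay–Münster (4.111)). [cite: Smit2023, §6.5 (6.74) and (6.85)–(6.86)] [cite: MontvayMunster1994, §4.2.3 (4.105) and (4.111)] -/
def sliceMassHop (U : GaugeConfig 3 S 𝔾) (mq : Fin Nf → ℝ) :
    Matrix (SliceColourVar Nf S) (SliceColourVar Nf S) ℂ :=
  Matrix.diagonal (fun p => ((mq p.1 + 4 : ℝ) : ℂ)) -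
    (1 / 2 : ℂ) • ∑ j : Fin 3, (colourHop U j + (colourHop U j)ᴴ)

/-- **Smit's `D(U)`**: `D = ∑ⱼ αⱼ (1/2i)(W_j − W_jᴴ) = ½∑ⱼ (W_j − W_jᴴ) ⊗ γ₄γⱼ`
(`αⱼ = iγ₄γⱼ`; spatial direction `j : Fin 3` is the four-torus direction `j.succ`), Hermitian;
`ψ̄(A ⊗ 1 + ½∑ⱼ(W_j − W_jᴴ) ⊗ γⱼ)ψ = ψ⁺γ₄Aψ + ψ⁺Dψ` is the slice part of the tree's
`wilsonDirac … m 1`. [cite: Smit2023, §6.5 (6.75)] -/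
def sliceDiracKinetic (U : GaugeConfig 3 S 𝔾) : Matrix (SliceQuarkVar Nf S) (SliceQuarkVar Nf S) ℂ :=
  (1 / 2 : ℂ) • ∑ j : Fin 3, sliceKron (colourHop U j - (colourHop U j)ᴴ)
    (euclideanGamma 0 * euclideanGamma j.succ)

/-- The nilpotent pair-coupling `N = P⁻DP⁺` of Smit (6.84)/(6.91) (`N² = 0` since `P⁺P⁻ = 0`,
so `e^{−N} = 1 − N`; `N† = P⁺DP⁻`). [cite: Smit2023, §6.5 (6.84)] -/
def sliceNilp (U : GaugeConfig 3 S 𝔾) : Matrix (SliceQuarkVar Nf S) (SliceQuarkVar Nf S) ℂ :=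
  sliceKron 1 timeProjMinus * sliceDiracKinetic U * sliceKron 1 timeProjPlus

/-- **One-particle matrix of the fermionic transfer operator**:
`M_F(U) = e^{−N} e^{−γ₄ ln A} e^{−N†} = (1 − N)(P⁺A⁻¹ + P⁻A)(1 − Nᴴ)` (`γ₄ = P⁺ − P⁻` commutes with
the spin-blind `A = A_red ⊗ 1`, so `e^{−γ₄ ln A} = A_red⁻¹ ⊗ P⁺ + A_red ⊗ P⁻`; `A⁻¹` is Mathlib's
`Matrix.inv`, junk `0` if `A` is singular, which is excluded for `m_f > −1`). [cite: Smit2023, §6.5 (6.91)] -/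
def fermionSliceMatrix (U : GaugeConfig 3 S 𝔾) (mq : Fin Nf → ℝ) :
    Matrix (SliceQuarkVar Nf S) (SliceQuarkVar Nf S) ℂ :=
  (1 - sliceNilp U) *
    (sliceKron (sliceMassHop U mq)⁻¹ timeProjPlus + sliceKron (sliceMassHop U mq) timeProjMinus) *
    (1 - (sliceNilp U)ᴴ)

/-- **The fermionic transfer operator `T̂_F(U)` of `r = 1` Wilson quarks in the background `U`**
(Smit (6.91), charge-conserving form; Lüscher 1977) on the Fock space of the slice quark modes:
`T̂_F(U) = e^{−ψ̂†Nψ̂} e^{−ψ̂†γ₄ ln A ψ̂} e^{Tr P⁺ ln A} e^{−ψ̂†N†ψ̂} = (det A_red)² · Γ(M_F(U))`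
(`e^{ψ̂†Xψ̂} = Γ(e^X)`, `Γ` multiplicative, `e^{Tr P⁺ ln A} = (det A_red)^{rank P⁺} = (det A_red)²`),
with `ψ̂ᵢ := annihilation i` the Jordan–Wigner operators of `HubbardWave0` (modes enumerated by
`sliceQuarkEquiv`). Hermitian, and positive definite when all `m_f > −1`
(`T̂_F = (det A_red)² YΓ(P⁺A⁻¹ + P⁻A)Y†`, `Y = Γ(1 − N)` invertible, `A > 0`); Smit's form (6.84)
in the `â`-modes is the same operator after the particle–hole transformation (6.89)–(6.90) on the
`P⁺` modes. [cite: Smit2023, §6.5 (6.84) and (6.91)] [cite: Luscher1977, pp. 283–292] -/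
def fermionSliceOp (U : GaugeConfig 3 S 𝔾) (mq : Fin Nf → ℝ) :
    Matrix (Finset (SliceFermiIdx Nf S)) (Finset (SliceFermiIdx Nf S)) ℂ :=
  ((sliceMassHop U mq).det ^ 2) •
    fockLift (Matrix.reindex sliceQuarkEquiv sliceQuarkEquiv (fermionSliceMatrix U mq))

/-- **The pure-gauge transfer kernel in temporal gauge** (Smit (4.121), (4.129); Creutz 1977;
Lüscher 1977) for the TREE's Wilson weight `exp(−β∑ₚ(3 − Re tr Uₚ))`, `β = 2/g₀²`:
`K_β(U, U') = e^{−(β/2)S₃(U)} · exp(−β∑_{l}(3 − Re tr(U_l U'_lᴴ))) · e^{−(β/2)S₃(U')}`, `S₃` the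
Wilson action of the spatial three-torus (spatial plaquettes split symmetrically between the two
slices; the middle factor is the temporal plaquettes between the slices). Symmetric and `> 0`; the
integral operator `T̂_U` it defines on `L²(SU(3)^{links}, Haar)` is positive for `β ≥ 0`
(character expansion, Smit §4.7). [cite: Smit2023, §4.6 (4.121)–(4.129)] [cite: Luscher1977, pp. 283–292] -/
def gaugeSliceKernel (β : ℝ) (U U' : GaugeConfig 3 S 𝔾) : ℝ :=
  Real.exp (-(β / 2) * wilsonAction (fundamentalRep (Fin 3)) U) *
    Real.exp (-(β * ∑ l : Edge 3 S,
      ((3 : ℝ) - ((U l : Matrix (Fin 3) (Fin 3) ℂ) * (U' l : Matrix (Fin 3) (Fin 3) ℂ)ᴴ).trace.re))) *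
    Real.exp (-(β / 2) * wilsonAction (fundamentalRep (Fin 3)) U')

/-- The transfer kernel is strictly positive. [folklore] -/
theorem gaugeSliceKernel_pos (β : ℝ) (U U' : GaugeConfig 3 S 𝔾) : 0 < gaugeSliceKernel β U U' :=
  mul_pos (mul_pos (Real.exp_pos _) (Real.exp_pos _)) (Real.exp_pos _)

/-- The transfer kernel is symmetric, `K(U, U') = K(U', U)` (`Re tr(VWᴴ) = Re tr(WVᴴ)`): the
kernel-level self-adjointness of `T̂_U`. [cite: Smit2023, §4.6 (4.129)] -/
theorem gaugeSliceKernel_symm (β : ℝ) (U U' : GaugeConfig 3 S 𝔾) :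
    gaugeSliceKernel β U U' = gaugeSliceKernel β U' U := by
  have htr : ∀ (V W : Matrix (Fin 3) (Fin 3) ℂ), (V * Wᴴ).trace.re = (W * Vᴴ).trace.re := by
    intro V W
    have h : W * Vᴴ = (V * Wᴴ)ᴴ := by rw [Matrix.conjTranspose_mul, Matrix.conjTranspose_conjTranspose]
    rw [h, Matrix.trace_conjTranspose, Complex.star_def, Complex.conj_re]
  unfold gaugeSliceKernel
  simp only [htr]
  ring

/-- The one-particle gauge rotation of a time-independent gauge transformation `g` on the slice
quark modes: `ψ_{f,x,a,α} ↦ ∑_b g(x)_{ab} ψ_{f,x,b,α}` (block-diagonal, spin- and flavour-blind).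
[cite: Smit2023, §4.6 (4.124)–(4.126)] -/
def sliceGaugeRot (g : TorusSite 3 S → 𝔾) : Matrix (SliceQuarkVar Nf S) (SliceQuarkVar Nf S) ℂ :=
  sliceKron (Matrix.of fun p q =>
    if p.1 = q.1 ∧ p.2.1 = q.2.1 then (g p.2.1 : Matrix (Fin 3) (Fin 3) ℂ) p.2.2 q.2.2 else 0) 1

/-- The unitary action `Γ(G_g)` of the gauge transformation `g` on the slice Fock space
(`Γ(G) ψ̂†(v) Γ(G)⁻¹ = ψ̂†(Gv)`). [cite: Smit2023, §4.6 (4.125)–(4.127)] -/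
def fockGaugeAct (g : TorusSite 3 S → 𝔾) :
    Matrix (Finset (SliceFermiIdx Nf S)) (Finset (SliceFermiIdx Nf S)) ℂ :=
  fockLift (Matrix.reindex sliceQuarkEquiv sliceQuarkEquiv (sliceGaugeRot (Nf := Nf) g))

variable (Nf S)

/-- Wave functions of the coordinate representation: Fock-vector-valued functions of the spatial
link variables (Smit (4.115)–(4.118), tensored with the quark Fock space). [cite: Smit2023, §4.6 (4.115)–(4.118)] -/
abbrev SliceWave : Type := GaugeConfig 3 S 𝔾 → Fock (SliceFermiIdx Nf S)

variable {Nf S}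

/-- **Gauss law**: `Ψ` is gauge invariant iff `Ψ(U^g) = Γ(G_g) Ψ(U)` for all time-independent
gauge transformations `g` (`U^g(x,j) = g(x)U(x,j)g(x+ĵ)⁻¹`, the tree's `gaugeTransform`; the Fock
factor rotates the quark modes, so that e.g. `∑_{ab}(U-path x→y)_{ab} ψ̂†_{x,a}ψ̂_{y,b}|0⟩` is
physical). The range of Smit's `P̂₀`. [cite: Smit2023, §4.6 (4.127) and (4.137)] -/
def IsGaugeInvariantWave (Ψ : SliceWave Nf S) : Prop :=
  ∀ (g : TorusSite 3 S → 𝔾) (U : GaugeConfig 3 S 𝔾), Ψ (gaugeTransform g U) = fockGaugeAct g *ᵥ Ψ U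

variable (Nf S) in
/-- The **form core**: continuous gauge-invariant wave functions (dense in the gauge-invariant
subspace of `L²(SU(3)^{links}, Haar) ⊗ Fock`, being the image of `C(SU(3)^{links}; Fock)` under
the averaging projection `P̂₀`). [cite: Smit2023, §4.6 (4.127)–(4.137)] -/
def transferCore : Set (SliceWave Nf S) := {Ψ | Continuous Ψ ∧ IsGaugeInvariantWave Ψ}

/-- The constant vacuum wave function `U ↦ |0⟩` is gauge invariant. [folklore] -/
theorem isGaugeInvariantWave_vacuum :
    IsGaugeInvariantWave (fun _ : GaugeConfig 3 S 𝔾 => (vacuum : Fock (SliceFermiIdx Nf S))) :=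
  fun _ _ => (fockLift_mulVec_vacuum _).symm

/-- Non-vacuity of the form core: it contains the constant vacuum wave function. [folklore] -/
theorem vacuum_mem_transferCore :
    (fun _ : GaugeConfig 3 S 𝔾 => (vacuum : Fock (SliceFermiIdx Nf S))) ∈ transferCore Nf S :=
  ⟨continuous_const, isGaugeInvariantWave_vacuum⟩

variable (S) in
/-- Product Haar probability measure on the spatial link variables `SU(3)^{Edge 3 S}` (the measure
of Smit (4.117)–(4.118)). [cite: Smit2023, §4.6 (4.117)–(4.118)] -/
def sliceHaar : Measure (GaugeConfig 3 S 𝔾) := Measure.pi fun _ : Edge 3 S => haarProbability 𝔾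

/-- **The `T̂_F`-weighted pairing** `𝔫(Φ, Ψ) = ⟨Φ, T̂_F Ψ⟩ = ∫ ⟨Φ(U), T̂_F(U)Ψ(U)⟩_Fock dU =
⟨T̂_F^{1/2}Φ, T̂_F^{1/2}Ψ⟩`: the inner product of `L² ⊗ Fock` transported along `Ψ ↦ T̂_F^{1/2}Ψ`
(Bochner integral; `⟨u, v⟩_Fock = star u ⬝ᵥ v`). [cite: Smit2023, §6.5 (6.87)] -/
def fermionWeightForm (mq : Fin Nf → ℝ) (Φ Ψ : SliceWave Nf S) : ℂ :=
  ∫ U, star (Φ U) ⬝ᵥ (fermionSliceOp U mq *ᵥ Ψ U) ∂(sliceHaar S)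

/-- On the constant vacuum wave function the weighted pairing is the Haar average of the
Dirac-sea factor: `⟨0|T̂_F(U)|0⟩ = (det A_red(U))²` (`Γ(M)|0⟩ = |0⟩`), i.e. `e^{Tr P⁺ ln A}` of
Smit (6.91). [cite: Smit2023, §6.5 (6.91)] -/
theorem fermionWeightForm_vacuum (mq : Fin Nf → ℝ) :
    fermionWeightForm (S := S) mq (fun _ => vacuum) (fun _ => vacuum) =
      ∫ U, (sliceMassHop (Nf := Nf) U mq).det ^ 2 ∂(sliceHaar S) := by
  unfold fermionWeightForm fermionSliceOp
  congr 1
  funext U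
  rw [Matrix.smul_mulVec, fockLift_mulVec_vacuum]
  simp [vacuum, dotProduct, Pi.single_apply, Finset.sum_ite_eq', apply_ite star]

/-- **The transfer form** `𝔱(Φ, Ψ) = ⟨T̂_FΦ, T̂_U T̂_FΨ⟩ =
∫∫ K_β(U,U') ⟨T̂_F(U)Φ(U), T̂_F(U')Ψ(U')⟩_Fock dU dU'`, i.e. `⟨T̂_F^{1/2}Φ, T̂ T̂_F^{1/2}Ψ⟩` for
Smit's `T̂ = T̂_F^{1/2} T̂_U T̂_F^{1/2}` (6.87) (on gauge-invariant `Ψ` the projector `P̂₀` is the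
identity). [cite: Smit2023, §6.5 (6.87)] [cite: Luscher1977, pp. 283–292] -/
def transferForm (β : ℝ) (mq : Fin Nf → ℝ) (Φ Ψ : SliceWave Nf S) : ℂ :=
  ∫ U, ∫ U', (gaugeSliceKernel β U U' : ℂ) *
    (star (fermionSliceOp U mq *ᵥ Φ U) ⬝ᵥ (fermionSliceOp U' mq *ᵥ Ψ U')) ∂(sliceHaar S) ∂(sliceHaar S)

/-- The **Rayleigh quotient** `R(Ψ) = 𝔱(Ψ,Ψ)/𝔫(Ψ,Ψ) = ⟨χ, T̂χ⟩/‖χ‖²`, `χ = T̂_F^{1/2}Ψ` (both forms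
are real on the diagonal). [cite: ReedSimonIV1978, Thm XIII.1] -/
def transferRayleigh (β : ℝ) (mq : Fin Nf → ℝ) (Ψ : SliceWave Nf S) : ℝ :=
  (transferForm β mq Ψ Ψ).re / (fermionWeightForm mq Ψ Ψ).re

variable (Nf S) in
/-- **Min–max levels of the QCD transfer operator on the gauge-invariant subspace**:
`λₙ = inf_{Φ₁,…,Φₙ ∈ core} sup {R(Ψ) : Ψ ∈ core, 𝔫(Ψ,Ψ) ≠ 0, 𝔫(Φᵢ,Ψ) = 0 ∀ i}` — by the min–max
principle the `(n+1)`-st largest eigenvalue of `T̂|_{gauge-inv}` counted with multiplicity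
(`T̂_U` has a continuous kernel on the compact `SU(3)^{links}`, so `T̂` is compact and these are
genuine eigenvalues, accumulating only at `0`); `λ₀ = ‖T̂|_{gauge-inv}‖` is the vacuum eigenvalue.
Junk (`sSup`/`sInf` conventions of `ℝ`) outside `β ≥ 0`, `m_f > −1`. [cite: ReedSimonIV1978, Thm XIII.1 (min–max)] [cite: Luscher1977, pp. 283–292] -/
def qcdTransferLevel (β : ℝ) (mq : Fin Nf → ℝ) (n : ℕ) : ℝ :=
  sInf ((fun Φ : Fin n → SliceWave Nf S =>
      sSup (transferRayleigh β mq '' {Ψ | Ψ ∈ transferCore Nf S ∧ fermionWeightForm mq Ψ Ψ ≠ 0 ∧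
        ∀ i, fermionWeightForm mq (Φ i) Ψ = 0})) '' {Φ | ∀ i, Φ i ∈ transferCore Nf S})

/-- **`qcdTransferGap N_f β S m`: the spectral gap of the positive transfer matrix of lattice QCD**
with `N_f` flavours of `r = 1` Wilson quarks (bare masses `m_f`, `κ_f = 1/(2m_f + 8)`), inverse bare
coupling `β = 2/g₀²` (tree normalisation of `wilsonMeasure`), on the full gauge-invariant subspace
of `L²(SU(3)^{Edge 3 S}, Haar) ⊗ Fock(slice quark modes)` of the spatial three-torus of side `S`:
`Δ = −log(λ₁/λ₀) = log λ₀ − log λ₁`, `λ₀ ≥ λ₁` the two top min–max levels (`qcdTransferLevel`),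
i.e. the energy, in lattice units, of the first excited state of `aH = −log(T̂/λ₀)` above the vacuum
(Lüscher 1977: `T̂` bounded, self-adjoint, strictly positive for `κ < 1/6`; explicit form
Smit (6.87)–(6.91)). `0` when the vacuum eigenvalue is degenerate; junk outside `β ≥ 0`, `m_f > −1`.
[cite: Luscher1977, pp. 283–292] [cite: Smit2023, §6.5 (6.87)–(6.91)] [cite: MontvayMunster1994, §4.2.3 (4.111)] -/
def qcdTransferGap (Nf : ℕ) (β : ℝ) (S : ℕ) [NeZero S] (mq : Fin Nf → ℝ) : ℝ :=
  Real.log (qcdTransferLevel Nf S β mq 0) - Real.log (qcdTransferLevel Nf S β mq 1)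

/-- Unfolding `qcdTransferGap` into the two top min–max levels. [folklore] -/
theorem qcdTransferGap_eq (Nf : ℕ) (β : ℝ) (S : ℕ) [NeZero S] (mq : Fin Nf → ℝ) :
    qcdTransferGap Nf β S mq =
      Real.log (qcdTransferLevel Nf S β mq 0) - Real.log (qcdTransferLevel Nf S β mq 1) := rfl

/-- The vacuum level is an unconstrained supremum: `λ₀ = sup {R(Ψ) : Ψ ∈ core, 𝔫(Ψ,Ψ) ≠ 0}`
(the `inf` over the unique empty family of constraints). [cite: ReedSimonIV1978, Thm XIII.1] -/
theorem qcdTransferLevel_zero (β : ℝ) (mq : Fin Nf → ℝ) :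
    qcdTransferLevel Nf S β mq 0 =
      sSup (transferRayleigh β mq '' {Ψ | Ψ ∈ transferCore Nf S ∧ fermionWeightForm mq Ψ Ψ ≠ 0}) := by
  unfold qcdTransferLevel
  have hset : {Φ : Fin 0 → SliceWave Nf S | ∀ i, Φ i ∈ transferCore Nf S} = {Fin.elim0} := by
    ext Φ
    simp only [Set.mem_setOf_eq, Set.mem_singleton_iff, IsEmpty.forall_iff, true_iff]
    exact funext fun i => Fin.elim0 i
  rw [hset, Set.image_singleton, csInf_singleton]
  simp

end Slice

end Literature.MathematicalPhysics.QuantumFieldTheory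

end
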